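import Summits.BirchSwinnertonDyer.BirchSwinnertonDyer.Theorems.ResidualThetaTransportAtTwoHeckeThetaPartnerAdicAtTwoCubicClosure
import Literature.NumberTheory.CubicFields.CubicResolventCharacter
import Mathlib.GroupTheory.Perm.Cycle.Type
import HarnessLib

/-!
# Galois action on the roots of the cubic in its `S₃`-closure

Route `ResidualThetaTransportAtTwo`, crux K0⁺ `HeckeThetaPartnerAdicAtTwo` (stmt-BirchSwinnertonDyer-20690),
helper §C3 of the line "proof from print".  THEOREMS ONLY (no definition, no named fact, no `sorry`).

`k` quadratic, `L ⊆ k̄` the `S₃`-closure of the cubic field `K_h = ℚ[X]/(h)` (`[L:k] = 3`, `L/ℚ` Galois,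
`ι : K_h → L`, `L` generated by the conjugates of `K_h`; tree theorem `exists_resolventClosure`), `S` the
three roots of `h` in `𝓞 L`:
* `map_mem_roots` — ring endomorphisms of `𝓞 L` permute `S`; `roots_map_eq` — the roots of
  `h` in `L` are the images of `S`; `minpoly_eq_of_mem_roots` — each root has minimal polynomial `h`;
* `smul_ne_of_ne_one` — **a non-trivial element of `Gal(L/k)` fixes no root** (it generates `Gal(L/k)`,
  whose fixed field is `k ∌ θ` as `3 ∤ 2`);
* `card_filter_smul_eq_eq_one` — **an element of `Gal(L/ℚ)` non-trivial on `k` fixes exactly one root**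
  (it is an involution `≠ 1` of the three roots: tree theorem `sq_eq_one_of_restrictNormal_ne_one`).
-/

set_option autoImplicit false
set_option linter.dupNamespace false

noncomputable section

open Polynomial Module NumberField IntermediateField
open Literature.NumberTheory.NumberFields Literature.NumberTheory.CubicFields
  Literature.NumberTheory.GaloisRepresentations

namespace Summit.BirchSwinnertonDyer.BirchSwinnertonDyer.Theorems.HeckeThetaPartner

section General

variable (a b c : ℤ) [hirr : Fact (Irreducible (MonicCubic.polyQ a b c))]
  (L : Type*) [Field L] [NumberField L] [Normal ℚ L] (ι : AdjoinRoot (MonicCubic.polyQ a b c) →ₐ[ℚ] L)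

omit hirr [NumberField L] [Normal ℚ L] in
/-- Ring endomorphisms of `𝓞 L` permute the roots of `h`. [folklore] -/
theorem map_mem_roots (φ : 𝓞 L →+* 𝓞 L) {θ : 𝓞 L}
    (hθ : θ ∈ ((MonicCubic.poly a b c).map (Int.castRingHom (𝓞 L))).roots) :
    φ θ ∈ ((MonicCubic.poly a b c).map (Int.castRingHom (𝓞 L))).roots := by
  have h0 : (MonicCubic.poly a b c).map (Int.castRingHom (𝓞 L)) ≠ 0 := ((MonicCubic.monic_poly a b c).map _).ne_zero
  rw [mem_roots h0, IsRoot.def] at hθ ⊢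
  have h1 : (((MonicCubic.poly a b c).map (Int.castRingHom (𝓞 L))).map φ).eval (φ θ) = 0 := by
    rw [eval_map, eval₂_hom, hθ, map_zero]
  rwa [Polynomial.map_map, RingHom.ext_int (φ.comp (Int.castRingHom (𝓞 L))) (Int.castRingHom (𝓞 L))] at h1

include ι in
/-- The roots of `h` in `L` are the images of its roots in `𝓞 L`. [folklore] -/
theorem roots_map_eq :
    ((MonicCubic.poly a b c).map (Int.castRingHom L)).roots =
      ((MonicCubic.poly a b c).map (Int.castRingHom (𝓞 L))).roots.map (algebraMap (𝓞 L) L) := by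
  obtain ⟨hcard, -⟩ := card_roots_ringOfIntegers_eq_three a b c L ι
  have h1 : (MonicCubic.poly a b c).map (Int.castRingHom L) =
      ((MonicCubic.poly a b c).map (Int.castRingHom (𝓞 L))).map (algebraMap (𝓞 L) L) := by
    rw [Polynomial.map_map, RingHom.ext_int ((algebraMap (𝓞 L) L).comp (Int.castRingHom (𝓞 L))) (Int.castRingHom L)]
  rw [h1]
  exact (roots_map_of_injective_of_card_eq_natDegree (IsFractionRing.injective (𝓞 L) L)
    (by rw [hcard, (MonicCubic.monic_poly a b c).natDegree_map, MonicCubic.natDegree_poly])).symm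

omit [Normal ℚ L] in
/-- Each root `θ ∈ 𝓞 L` of `h` has `h(θ) = 0` in `L` and minimal polynomial `h` over `ℚ`. [folklore] -/
theorem minpoly_eq_of_mem_roots {θ : 𝓞 L}
    (hθ : θ ∈ ((MonicCubic.poly a b c).map (Int.castRingHom (𝓞 L))).roots) :
    minpoly ℚ (θ : L) = MonicCubic.polyQ a b c := by
  have h0 : (MonicCubic.poly a b c).map (Int.castRingHom (𝓞 L)) ≠ 0 := ((MonicCubic.monic_poly a b c).map _).ne_zero
  rw [mem_roots h0, IsRoot.def] at hθ
  have hθL : aeval (θ : L) (MonicCubic.poly a b c) = 0 := by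
    rw [aeval_def, ← RingHom.ext_int ((algebraMap (𝓞 L) L).comp (Int.castRingHom (𝓞 L))) (algebraMap ℤ L),
      ← Polynomial.eval₂_map, ← eval_map, Polynomial.map_map] at *
    have h1 : (((MonicCubic.poly a b c).map (Int.castRingHom (𝓞 L))).map (algebraMap (𝓞 L) L)).eval (θ : L) = 0 := by
      rw [eval_map, eval₂_hom, hθ, map_zero]
    rwa [Polynomial.map_map] at h1
  exact MonicCubic.minpoly_rat_eq hirr.out hθL

end General

section Closure

variable {k : Type} [Field k] [NumberField k] [IsGalois ℚ k]
  (L : IntermediateField k (AlgebraicClosure k)) [FiniteDimensional k L] [IsGalois ℚ L] [NumberField L]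
  (a b c : ℤ) [hirr : Fact (Irreducible (MonicCubic.polyQ a b c))]
  (ι : AdjoinRoot (MonicCubic.polyQ a b c) →ₐ[ℚ] L)

/-- **A non-trivial element of `Gal(L/k)` fixes no root of `h`**: it generates the group of prime
order `3`, whose fixed field is `k`, and a root `θ` of the irreducible cubic `h` is not in the
quadratic field `k`. [folklore] -/
theorem smul_ne_of_ne_one (hk : finrank ℚ k = 2) (h3 : finrank k L = 3) (φ : L ≃ₐ[k] L) (hφ : φ ≠ 1)
    {θ : 𝓞 L} (hθ : θ ∈ ((MonicCubic.poly a b c).map (Int.castRingHom (𝓞 L))).roots) : φ • θ ≠ θ := by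
  intro heq
  haveI : IsGalois k L := by
    haveI : Normal k L := Normal.tower_top_of_normal ℚ k L
    haveI : Algebra.IsSeparable k L := Algebra.IsAlgebraic.isSeparable_of_perfectField
    exact IsGalois.mk
  haveI : Fact (Nat.Prime 3) := ⟨Nat.prime_three⟩
  have hcard : Nat.card (L ≃ₐ[k] L) = 3 := by rw [IsGalois.card_aut_eq_finrank, h3]
  have hφθ : φ (θ : L) = θ := by
    rw [← RingOfIntegers.coe_galois_smul, heq]
  have hfix : ∀ g : L ≃ₐ[k] L, g (θ : L) = θ := by
    intro g
    have hφmem : φ ∈ MulAction.stabilizer (L ≃ₐ[k] L) (θ : L) := hφθ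
    have hg : g ∈ Subgroup.zpowers φ := mem_zpowers_of_prime_card hcard hφ
    exact (Subgroup.zpowers_le.mpr hφmem) hg
  obtain ⟨t, ht⟩ := (IsGalois.mem_range_algebraMap_iff_fixed (θ : L)).mpr hfix
  have hmin := minpoly_eq_of_mem_roots a b c L hθ
  have h1 : minpoly ℚ t = MonicCubic.polyQ a b c := by
    rw [← hmin, ← ht, minpoly.algebraMap_eq (algebraMap k L).injective]
  have h2 : (minpoly ℚ t).natDegree ≤ finrank ℚ k := minpoly.natDegree_le t
  rw [h1, MonicCubic.natDegree_polyQ, hk] at h2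
  omega

include ι in
open scoped Classical in
/-- **An element of `Gal(L/ℚ)` non-trivial on `k` fixes exactly one root of `h`** (`K_h` not Galois,
`L` generated by the conjugates of `K_h`): it is an involution (`sq_eq_one_of_restrictNormal_ne_one`)
of the three roots, so it fixes an odd number of them, and not all three (it would be trivial on `L`).
[folklore] -/
theorem card_filter_smul_eq_eq_one (hk : finrank ℚ k = 2) (h3 : finrank k L = 3)
    (hKG : ¬ IsGalois ℚ (AdjoinRoot (MonicCubic.polyQ a b c)))
    (hgen : (⨆ σ : AdjoinRoot (MonicCubic.polyQ a b c) →ₐ[ℚ] L, σ.fieldRange) = ⊤)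
    (Φ : L ≃ₐ[ℚ] L) (hΦ : Φ.restrictNormal k ≠ 1) :
    (((MonicCubic.poly a b c).map (Int.castRingHom (𝓞 L))).roots.toFinset.filter
      (fun θ => Φ • θ = θ)).card = 1 := by
  classical
  haveI : Fact (Nat.Prime 2) := ⟨Nat.prime_two⟩
  obtain ⟨hcard, hnodup⟩ := card_roots_ringOfIntegers_eq_three a b c L ι
  set S := ((MonicCubic.poly a b c).map (Int.castRingHom (𝓞 L))).roots with hS
  set A := S.toFinset with hA
  have hAcard : A.card = 3 := by rw [hA, Multiset.toFinset_card_of_nodup hnodup, hcard]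
  have hΦ2 : Φ ^ 2 = 1 := sq_eq_one_of_restrictNormal_ne_one L hk h3 hKG ι hΦ
  have hΦ1 : Φ ≠ 1 := by
    rintro rfl
    exact hΦ (map_one (AlgEquiv.restrictNormalHom (F := ℚ) (K₁ := L) k))
  -- `Φ` permutes `A`
  have hmem : ∀ θ ∈ A, Φ • θ ∈ A := by
    intro θ hθ
    rw [hA, Multiset.mem_toFinset] at hθ ⊢
    exact map_mem_roots a b c L (MulSemiringAction.toRingHom _ (𝓞 L) Φ) hθ
  -- the involution on `A` and its fixed points
  let f : Function.End {θ // θ ∈ A} := fun x => ⟨Φ • x.1, hmem x.1 x.2⟩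
  have hf : f ^ 2 ^ 1 = 1 := by
    rw [pow_one, sq]
    funext x
    apply Subtype.ext
    show Φ • Φ • x.1 = x.1
    rw [← mul_smul, ← sq, hΦ2, one_smul]
  have hmod := Equiv.Perm.card_fixedPoints_modEq (p := 2) (n := 1) hf
  have hcardA : Fintype.card {θ // θ ∈ A} = 3 := by rw [Fintype.card_coe, hAcard]
  let e : ↥(Function.fixedPoints f) ≃ {θ // θ ∈ A.filter (fun θ => Φ • θ = θ)} :=
    { toFun := fun x => ⟨x.1.1, Finset.mem_filter.mpr ⟨x.1.2, congrArg Subtype.val x.2⟩⟩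
      invFun := fun y => ⟨⟨y.1, (Finset.mem_filter.mp y.2).1⟩, Subtype.ext (Finset.mem_filter.mp y.2).2⟩
      left_inv := fun x => rfl
      right_inv := fun y => rfl }
  have hcardF : Fintype.card ↥(Function.fixedPoints f) = (A.filter (fun θ => Φ • θ = θ)).card := by
    rw [Fintype.card_congr e, Fintype.card_coe]
  rw [hcardA, hcardF] at hmod
  -- the number `r` of fixed roots is odd, `≤ 3`, and `≠ 3`
  have hle : (A.filter (fun θ => Φ • θ = θ)).card ≤ 3 := by
    rw [← hAcard]; exact Finset.card_filter_le _ _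
  have hne : (A.filter (fun θ => Φ • θ = θ)).card ≠ 3 := by
    intro h3'
    have hall : A.filter (fun θ => Φ • θ = θ) = A :=
      Finset.eq_of_subset_of_card_le (Finset.filter_subset _ _) (by rw [h3', hAcard])
    have hfixall : ∀ θ ∈ A, Φ • θ = θ := fun θ hθ => by
      rw [← hall] at hθ
      exact (Finset.mem_filter.mp hθ).2
    apply hΦ1
    refine algEquiv_eq_one_of_forall_comp_eq hgen fun σ => ?_
    apply AdjoinRoot.algHom_ext
    change Φ (σ (AdjoinRoot.root (MonicCubic.polyQ a b c))) = σ (AdjoinRoot.root (MonicCubic.polyQ a b c))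
    -- `σ(θ₀)` is a root of `h` in `L`, hence the image of a root in `𝓞 L`
    have hroot : σ (AdjoinRoot.root (MonicCubic.polyQ a b c)) ∈
        ((MonicCubic.poly a b c).map (Int.castRingHom L)).roots := by
      rw [mem_roots (((MonicCubic.monic_poly a b c).map _).ne_zero), IsRoot.def, eval_map]
      have h0 := aeval_algHom_apply ((σ : AdjoinRoot (MonicCubic.polyQ a b c) →+* L).toIntAlgHom)
        (AdjoinRoot.root (MonicCubic.polyQ a b c)) (MonicCubic.poly a b c)
      rw [aeval_root_poly, map_zero, aeval_def] at h0
      simpa [algebraMap_int_eq] using h0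
    rw [roots_map_eq a b c L ι, Multiset.mem_map] at hroot
    obtain ⟨θ, hθ, hθσ⟩ := hroot
    rw [← hθσ]
    show Φ (θ : L) = θ
    rw [← RingOfIntegers.coe_galois_smul, hfixall θ (by rw [hA, Multiset.mem_toFinset]; exact hθ)]
  have hodd : (A.filter (fun θ => Φ • θ = θ)).card % 2 = 1 := by
    have := hmod
    rw [Nat.ModEq] at this
    omega
  omega

end Closure

end Summit.BirchSwinnertonDyer.BirchSwinnertonDyer.Theorems.HeckeThetaPartner

end
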